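import Summits.Ventures.CertifiedManyBodySolver.Rows.SourcedTorusRowsBridge
import Literature.MathematicalPhysics.QuantumLattice.DWaveSourceEnergyDensityRowReaders
import HarnessLib

/-!
# PINNING-FIELD rows read in the THERMODYNAMIC LIMIT: the uniform energy cells as bounds on the
# torus-limit energy density `e_src`, on the grand-canonical Legendre object, on canonical tangents, and
# as chords on thermodynamic-limit ground states — with the two rows of a chord on DIFFERENT side
# progressions

HONEST FRAMING: zero compute; nothing here is a number of record by itself — every statement takes the
certified energy cells of `Rows/SourcedTorusRows.lean` as HYPOTHESES. A response at FIXED `h > 0` is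
symmetry-allowed («finite-h response (certified)», cell wording W1); NOT an order parameter, NOT a statement at
`h → 0`, NOT a superconductivity verdict.

Venture `CertifiedManyBodySolver`, cell `hubbard-cq` (rung CQ, CQ-TABLE §B1/§B2/§B1-U), seat `hubbard-cq-obsth-2`
(row «h-chord transport nodes: the thermodynamic-limit object»). Companion of
`Rows/SourcedTorusRowsBridge.lean` (the cells ↔ the `∀ L ≥ L₀` shapes) and of the Literature layer
`DWaveSourceEnergyDensityEnsembles` / `…RowReaders` (`e_src(t',U,μ,h) = dWaveSourceEnergyDensityTT'` EXISTS,
equals the infimum of the sourced mean energy over translation-invariant states, equals the Legendre transform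
`gcEnergyDensityTT' 1 t' U μ` of the canonical `energyDensityTT'` at `h = 0`; torus-limit ground states are
mean-energy minimisers). OBJECTS: the uniform cells `SourcedEnergyLowerRow tp U μ h q L₀ e` («`e·L² ≤ E₀(A_L)`
for every side `L ≥ L₀` with `q ∣ L`») and `SourcedEnergyUpperRow`, `q ≥ 1`.

* §1 CELLS ⇒ `e_src`: a floor cell on ANY side progression `q ≥ 1` is `e ≤ e_src(tp,U,μ,h)`, a ceiling cell is
  `e_src ≤ e'` (`SourcedEnergyLowerRow.le_dWaveSourceEnergyDensityTT'`, `SourcedEnergyUpperRow.dWaveSourceEnergyDensityTT'_le`;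
  `tp = 0` on `dWaveSourceEnergyDensity`); hence CONSISTENCY ACROSS PROGRESSIONS (`e ≤ e'` even when the floor is an
  SDP window row, `q = 1`, and the ceiling a `4 × 4`-tiling row, `q = 4`) and the every-translation-invariant-state
  reading `e ≤ E^{μ}_h(ω)` (the `hloMinus / hloPlus` slots of the infinite-volume bracket files).
* §2 `h = 0` CELLS ⇒ the Legendre object and canonical TANGENTS (`U ≥ 0`): `e ≤ gcEnergyDensityTT' 1 tp U μ` (the
  premise `hμ` of `TIGrandCanonicalChordFloor`), `gcEnergyDensityTT' 1 tp U μ ≤ e'`, and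
  `e + μ·n ≤ energyDensityTT' 1 tp U n` at EVERY density `n ∈ [0,2)` — a source-free grand-canonical menu leg is
  a canonical floor of the same class as the canonical anchor rows.
* §3 CHORDS ON THERMODYNAMIC-LIMIT GROUND STATES: for every torus limit `ω` of unit ground-state vectors of
  `A_L(tp,U,μ,h)` (along any divergent side sequence), a floor cell at a SMALLER field `h₁ < h` and a ceiling cell
  AT `h` — on arbitrary, possibly different, progressions — give the T1 FLOOR
  `(e − e')/(2(h − h₁)) ≤ Re ω(P₀^d)`; a ceiling at `h` and a floor at a LARGER field `h₂ > h` give the CEILING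
  `Re ω(P₀^d) ≤ (e' − e₂)/(2(h₂ − h))`; three cells at `(μ − δ, h)`, `(μ, h)`, `(μ + δ, h)` bracket the DENSITY
  `ρ(ω)`. (The along-one-sequence consumers `PairSourcedTorusLimitResponse` need all rows on the ground states' own
  side sequence; going through `e_src` removes that restriction.)

CONVENTION: `Re ω(P₀^d)`, `P₀^d = localPairAt ({0} ∪ unitSteps) dWaveFormFactor 0`, is the thermodynamic-limit
`d`-wave pair amplitude per site of the limit state — the limit of the tree's `m_L = Re⟨Δ_d⟩/L²`
(`torusAvgExpect_localPairAt_zero`), HALF of Koma–Tasaki's `⟨O⟩/|Λ|`; chords carry the factor `2`.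

No definition, no named fact, no `sorry`.

References: T. Koma, H. Tasaki, J. Stat. Phys. 76 (1994) 745, §1 [cite: KomaTasaki1994, §1]; R. B. Griffiths,
Phys. Rev. 152 (1966) 240, §II [cite: Griffiths1966, §II]; D. Ruelle, *Statistical Mechanics* (1969) §3.4
[cite: Ruelle1969, §3.4]; O. Bratteli, A. Kishimoto, D. W. Robinson, Commun. Math. Phys. 64 (1978) 41, Thm. 2
[cite: BratteliKishimotoRobinson1978, Thm. 2].
-/

noncomputable section

namespace Summit.Ventures.CertifiedManyBodySolver

open Literature.MathematicalPhysics.QuantumLattice Literature.MathematicalPhysics.QuantumLattice.ThermodynamicLimit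
open Literature.Probability.LatticeModels HubbardWave0 _root_.Filter _root_.Matrix
open scoped _root_.Topology

variable {tp U μ h : ℝ} {e e' : ℚ} {q q' L₀ L₀' : ℕ}

/-! ## §1  Cells ⇒ the torus-limit energy density `e_src` -/

section EnergyDensity

/-- **A uniform FLOOR cell is a floor on `e_src`**: `SourcedEnergyLowerRow tp U μ h q L₀ e` with `q ≥ 1` gives
`e ≤ e_src(tp,U,μ,h) = dWaveSourceEnergyDensityTT' tp U μ h`. [cite: Ruelle1969, §3.4] -/
theorem SourcedEnergyLowerRow.le_dWaveSourceEnergyDensityTT' (hrow : SourcedEnergyLowerRow tp U μ h q L₀ e)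
    (hq : 0 < q) : ((e : ℚ) : ℝ) ≤ dWaveSourceEnergyDensityTT' tp U μ h :=
  dWaveSourceEnergyDensityTT'_ge_of_forall_dvd_le tp U μ h (L₀ := L₀) hq fun L _ hL hqL =>
    SourcedTorusEnergyLowerRow.iff_le_groundEnergy.1 (hrow L hL hqL)

/-- **A uniform CEILING cell is a ceiling on `e_src`**: `SourcedEnergyUpperRow tp U μ h q L₀ e'` with `q ≥ 1` gives
`e_src(tp,U,μ,h) ≤ e'`. [cite: Ruelle1969, §3.4] -/
theorem SourcedEnergyUpperRow.dWaveSourceEnergyDensityTT'_le (hrow : SourcedEnergyUpperRow tp U μ h q L₀ e')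
    (hq : 0 < q) : dWaveSourceEnergyDensityTT' tp U μ h ≤ ((e' : ℚ) : ℝ) :=
  dWaveSourceEnergyDensityTT'_le_of_forall_dvd_le tp U μ h (L₀ := L₀) hq fun L _ hL hqL =>
    SourcedTorusEnergyUpperRow.iff_groundEnergy_le.1 (hrow L hL hqL)

/-- `tp = 0` form on the tree's `dWaveSourceEnergyDensity U μ h`. [cite: Ruelle1969, §3.4] -/
theorem SourcedEnergyLowerRow.le_dWaveSourceEnergyDensity (hrow : SourcedEnergyLowerRow 0 U μ h q L₀ e)
    (hq : 0 < q) : ((e : ℚ) : ℝ) ≤ dWaveSourceEnergyDensity U μ h := by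
  rw [← dWaveSourceEnergyDensityTT'_zero_tp]
  exact hrow.le_dWaveSourceEnergyDensityTT' hq

/-- `tp = 0` ceiling form. [cite: Ruelle1969, §3.4] -/
theorem SourcedEnergyUpperRow.dWaveSourceEnergyDensity_le (hrow : SourcedEnergyUpperRow 0 U μ h q L₀ e')
    (hq : 0 < q) : dWaveSourceEnergyDensity U μ h ≤ ((e' : ℚ) : ℝ) := by
  rw [← dWaveSourceEnergyDensityTT'_zero_tp]
  exact hrow.dWaveSourceEnergyDensityTT'_le hq

/-- **CONSISTENCY ACROSS SIDE PROGRESSIONS**: a floor cell (progression `q`) and a ceiling cell (progression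
`q'`) at the same `(tp,U,μ,h)` satisfy `e ≤ e'` — both are bounds on the one number `e_src` (a certified pair with
`e' < e` is an EVENT: one of the two files is wrong). [cite: Ruelle1969, §3.4] -/
theorem SourcedEnergyLowerRow.le_of_upperRow_any_progression (hlo : SourcedEnergyLowerRow tp U μ h q L₀ e)
    (hq : 0 < q) (hhi : SourcedEnergyUpperRow tp U μ h q' L₀' e') (hq' : 0 < q') : e ≤ e' := by
  exact_mod_cast (hlo.le_dWaveSourceEnergyDensityTT' hq).trans (hhi.dWaveSourceEnergyDensityTT'_le hq')

/-- **A floor cell bounds the sourced mean energy of EVERY translation-invariant infinite-volume state**: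
`e ≤ E^{μ}_h(ω) = ω.meanEnergy (hubbardTTPrimeSourcedInteraction 1 tp U μ dWaveFormFactor h) 1` — the `hloMinus` /
`hloPlus` slots of `pairAmplitude_mem_Icc_of_bounds` and of the infinite-volume chord-floor files.
[cite: BratteliKishimotoRobinson1978, Thm. 2] -/
theorem SourcedEnergyLowerRow.le_meanEnergy_sourced (hrow : SourcedEnergyLowerRow tp U μ h q L₀ e) (hq : 0 < q)
    {ω : InfVolFermionState 2} (hω : ω.IsTranslationInvariant) :
    ((e : ℚ) : ℝ) ≤ ω.meanEnergy (hubbardTTPrimeSourcedInteraction 1 tp U μ dWaveFormFactor h) 1 :=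
  (hrow.le_dWaveSourceEnergyDensityTT' hq).trans (dWaveSourceEnergyDensityTT'_le_meanEnergy_sourced tp U μ h hω)

end EnergyDensity

/-! ## §2  `h = 0` cells ⇒ the Legendre object and canonical tangent floors (`U ≥ 0`) -/

section Legendre

/-- **A source-free FLOOR cell is a floor on the grand-canonical Legendre object**:
`SourcedEnergyLowerRow tp U μ 0 q L₀ e` (`q ≥ 1`, `U ≥ 0`) gives `e ≤ gcEnergyDensityTT' 1 tp U μ` — the premise
`hμ` of `Observables.TIGrandCanonicalChordFloor`. [cite: Ruelle1969, §3.4] -/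
theorem SourcedEnergyLowerRow.le_gcEnergyDensityTT' (hrow : SourcedEnergyLowerRow tp U μ 0 q L₀ e) (hq : 0 < q)
    (hU : 0 ≤ U) : ((e : ℚ) : ℝ) ≤ gcEnergyDensityTT' 1 tp U μ := by
  rw [← dWaveSourceEnergyDensityTT'_zero_eq_gcEnergyDensityTT' tp hU μ]
  exact hrow.le_dWaveSourceEnergyDensityTT' hq

/-- **A source-free CEILING cell caps the Legendre object**: `gcEnergyDensityTT' 1 tp U μ ≤ e'`.
[cite: Ruelle1969, §3.4] -/
theorem SourcedEnergyUpperRow.gcEnergyDensityTT'_le (hrow : SourcedEnergyUpperRow tp U μ 0 q L₀ e') (hq : 0 < q)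
    (hU : 0 ≤ U) : gcEnergyDensityTT' 1 tp U μ ≤ ((e' : ℚ) : ℝ) := by
  rw [← dWaveSourceEnergyDensityTT'_zero_eq_gcEnergyDensityTT' tp hU μ]
  exact hrow.dWaveSourceEnergyDensityTT'_le hq

/-- **A source-free FLOOR cell is a canonical TANGENT floor at every density**:
`e + μ·n ≤ energyDensityTT' 1 tp U n` for every `n ∈ [0,2)` (`U ≥ 0`) — at `(tp, U, n) = (0, 8, 7/8)` a number of the
same class as the canonical anchor rows, from a grand-canonical menu leg. [cite: Ruelle1969, §3.4] -/
theorem SourcedEnergyLowerRow.add_mul_le_energyDensityTT' (hrow : SourcedEnergyLowerRow tp U μ 0 q L₀ e)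
    (hq : 0 < q) (hU : 0 ≤ U) {n : ℝ} (hn0 : 0 ≤ n) (hn2 : n < 2) :
    ((e : ℚ) : ℝ) + μ * n ≤ energyDensityTT' 1 tp U n := by
  have h1 := hrow.le_gcEnergyDensityTT' hq hU
  linarith [gcEnergyDensityTT'_add_mul_le 1 tp hU μ hn0 hn2]

/-- **A source-free FLOOR cell bounds `e^{1,tp,U}(ω) − μρ(ω)` for EVERY translation-invariant `ω`** (no sign
condition on `U`; the `μ`-pencil mean energy `ω.meanEnergy (hubbardTTPrimeMuInteraction 1 tp U μ) 1`).
[cite: BratteliKishimotoRobinson1978, Thm. 2] -/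
theorem SourcedEnergyLowerRow.le_meanEnergy_hubbardTTPrimeMu (hrow : SourcedEnergyLowerRow tp U μ 0 q L₀ e)
    (hq : 0 < q) {ω : InfVolFermionState 2} (hω : ω.IsTranslationInvariant) :
    ((e : ℚ) : ℝ) ≤ ω.meanEnergy (hubbardTTPrimeMuInteraction 1 tp U μ) 1 := by
  have h1 := hrow.le_meanEnergy_sourced hq hω
  rwa [InfVolFermionState.meanEnergy_hubbardTTPrimeSourced, zero_mul, sub_zero,
    ← InfVolFermionState.meanEnergy_hubbardTTPrimeMu] at h1

end Legendre

/-! ## §3  Chords on thermodynamic-limit ground states, rows on arbitrary side progressions -/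

section Chords

variable {ω : InfVolFermionState 2} {ψ : ∀ L, Fock (Orb (FermionTorus 2 L))} {Ls : ℕ → ℕ}

/-- **T1 FLOOR on a thermodynamic-limit ground state from two cells on arbitrary progressions.** Let `ω` be a
torus limit (along any divergent side sequence) of unit ground-state vectors of `A_L(tp,U,μ,h)`; let a FLOOR cell
`e` hold at a smaller field `h₁ < h` (progression `q`) and a CEILING cell `e'` at the field `h` (progression `q'`).
Then `(e − e')/(2(h − h₁)) ≤ Re ω(P₀^d)`. With `h₁ = 0` this is the «source-free floor + one sourced cap» floor.
[cite: KomaTasaki1994, §1] -/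
theorem SourcedEnergyLowerRow.chordFloor_torusLimit [hL0 : ∀ j, NeZero (Ls j)]
    (hω : ω.IsTorusLimitOf ψ Ls) (hLs : Tendsto Ls atTop atTop) (hψ : ∀ j, star (ψ (Ls j)) ⬝ᵥ ψ (Ls j) = 1)
    (hgs : ∀ j, dWaveSourceTorusTT' (Ls j) tp U μ h *ᵥ ψ (Ls j) =
      ((Matrix.groundEnergy (dWaveSourceTorusTT' (Ls j) tp U μ h) : ℝ) : ℂ) • ψ (Ls j))
    {h₁ : ℝ} (hlt : h₁ < h) (hlo : SourcedEnergyLowerRow tp U μ h₁ q L₀ e) (hq : 0 < q)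
    (hhi : SourcedEnergyUpperRow tp U μ h q' L₀' e') (hq' : 0 < q') :
    (((e : ℚ) : ℝ) - ((e' : ℚ) : ℝ)) / (2 * (h - h₁)) ≤
      (ω.expect (pairRegion (insert (0 : Site 2) unitSteps) 0)
        (localPairAt (insert 0 unitSteps) dWaveFormFactor 0)).re := by
  have hδ : 0 < h - h₁ := sub_pos.2 hlt
  obtain ⟨hsec, -⟩ := hω.two_mul_re_expect_localPairAt_mem_secant_brackets hLs hψ tp U μ h hgs hδ
  rw [show h - (h - h₁) = h₁ by ring] at hsec
  have h1 := hlo.le_dWaveSourceEnergyDensityTT' hq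
  have h2 := hhi.dWaveSourceEnergyDensityTT'_le hq'
  have h3 : (((e : ℚ) : ℝ) - ((e' : ℚ) : ℝ)) / (h - h₁) ≤
      (dWaveSourceEnergyDensityTT' tp U μ h₁ - dWaveSourceEnergyDensityTT' tp U μ h) / (h - h₁) :=
    div_le_div_of_nonneg_right (by linarith) hδ.le
  rw [mul_comm, ← div_div]
  linarith [h3.trans hsec]

/-- **CEILING on a thermodynamic-limit ground state**: a CEILING cell `e'` at the field `h` and a FLOOR cell `e₂`
at a larger field `h₂ > h` (arbitrary progressions) give `Re ω(P₀^d) ≤ (e' − e₂)/(2(h₂ − h))`. A ceiling; never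
speaks to presence. [cite: KomaTasaki1994, §1] -/
theorem SourcedEnergyUpperRow.chordCeiling_torusLimit [hL0 : ∀ j, NeZero (Ls j)]
    (hω : ω.IsTorusLimitOf ψ Ls) (hLs : Tendsto Ls atTop atTop) (hψ : ∀ j, star (ψ (Ls j)) ⬝ᵥ ψ (Ls j) = 1)
    (hgs : ∀ j, dWaveSourceTorusTT' (Ls j) tp U μ h *ᵥ ψ (Ls j) =
      ((Matrix.groundEnergy (dWaveSourceTorusTT' (Ls j) tp U μ h) : ℝ) : ℂ) • ψ (Ls j))
    (hhi : SourcedEnergyUpperRow tp U μ h q' L₀' e') (hq' : 0 < q')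
    {h₂ : ℝ} (hlt : h < h₂) {e₂ : ℚ} (hlo : SourcedEnergyLowerRow tp U μ h₂ q L₀ e₂) (hq : 0 < q) :
    (ω.expect (pairRegion (insert (0 : Site 2) unitSteps) 0)
        (localPairAt (insert 0 unitSteps) dWaveFormFactor 0)).re ≤
      (((e' : ℚ) : ℝ) - ((e₂ : ℚ) : ℝ)) / (2 * (h₂ - h)) := by
  have hδ : 0 < h₂ - h := sub_pos.2 hlt
  obtain ⟨-, hsec⟩ := hω.two_mul_re_expect_localPairAt_mem_secant_brackets hLs hψ tp U μ h hgs hδ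
  rw [show h + (h₂ - h) = h₂ by ring] at hsec
  have h1 := hlo.le_dWaveSourceEnergyDensityTT' hq
  have h2 := hhi.dWaveSourceEnergyDensityTT'_le hq'
  have h3 : (dWaveSourceEnergyDensityTT' tp U μ h - dWaveSourceEnergyDensityTT' tp U μ h₂) / (h₂ - h) ≤
      (((e' : ℚ) : ℝ) - ((e₂ : ℚ) : ℝ)) / (h₂ - h) :=
    div_le_div_of_nonneg_right (by linarith) hδ.le
  rw [mul_comm, ← div_div]
  linarith [hsec.trans h3]

/-- **DENSITY of a thermodynamic-limit grand-canonical ground state from three cells at one field**: FLOOR cells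
`e₋` at `(μ − δ, h)` and `e₊` at `(μ + δ, h)` and a CEILING cell `e'` at `(μ, h)` (arbitrary progressions,
`δ > 0`) give `(e₋ − e')/δ ≤ ρ(ω) ≤ (e' − e₊)/δ` for every torus limit `ω` of unit ground-state vectors of
`A_L(tp,U,μ,h)` — the certified conversion term between a grand-canonical leg at `μ` and a fixed-filling
sentence. [cite: Ruelle1969, §3.4] -/
theorem SourcedEnergyUpperRow.density_mem_Icc_torusLimit [hL0 : ∀ j, NeZero (Ls j)]
    (hω : ω.IsTorusLimitOf ψ Ls) (hLs : Tendsto Ls atTop atTop) (hψ : ∀ j, star (ψ (Ls j)) ⬝ᵥ ψ (Ls j) = 1)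
    (hgs : ∀ j, dWaveSourceTorusTT' (Ls j) tp U μ h *ᵥ ψ (Ls j) =
      ((Matrix.groundEnergy (dWaveSourceTorusTT' (Ls j) tp U μ h) : ℝ) : ℂ) • ψ (Ls j))
    (hhi : SourcedEnergyUpperRow tp U μ h q' L₀' e') (hq' : 0 < q')
    {δ : ℝ} (hδ : 0 < δ) {eMinus ePlus : ℚ} {q₁ q₂ L₁ L₂ : ℕ}
    (hloMinus : SourcedEnergyLowerRow tp U (μ - δ) h q₁ L₁ eMinus) (hq₁ : 0 < q₁)
    (hloPlus : SourcedEnergyLowerRow tp U (μ + δ) h q₂ L₂ ePlus) (hq₂ : 0 < q₂) :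
    ω.density ∈ Set.Icc ((((eMinus : ℚ) : ℝ) - ((e' : ℚ) : ℝ)) / δ) ((((e' : ℚ) : ℝ) - ((ePlus : ℚ) : ℝ)) / δ) :=
  hω.density_mem_Icc_of_dWaveSourceEnergyDensityTT'_bounds hLs hψ tp U μ h hgs hδ
    (hloMinus.le_dWaveSourceEnergyDensityTT' hq₁) (hloPlus.le_dWaveSourceEnergyDensityTT' hq₂)
    (hhi.dWaveSourceEnergyDensityTT'_le hq')

end Chords

end Summit.Ventures.CertifiedManyBodySolver

end
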